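import Summits.ABC.ABC.Theses.TwistAmplification
import Literature.NumberTheory.DiophantineGeometry.SquarefulSums

/-!
# Crux `TwistAmplification.MazurKaneLaw` (stmt-ABC-2757): a gauge at `s = 3/2` — three squareful numbers

Support file (line `fibre-toolkit-lp-wall-map`, open stub S5 `deepResidual` = the crux on the wild boxes for
`s ∈ (1, 5/3)`). WHAT THE DEEP RANGE CONTAINS, kernel-checked: the crux at the single point `s = 3/2` already gives
the CONJECTURED exponent `1/2` for primitive sums of three squareful numbers `x + y = z ≤ B`
(Browning–Van Valckenborgh 2012, Conjecture 1: `N₁(B) ~ c·B^{1/2}`; their Theorem 2 — the record — is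
`N₁(B) ≪ B^{3/5} (log B)^{12}`, tree `SquarefulSumUpperBound`), because a squareful abc triple has
`rad(abc)² ≤ abc < c³`, i.e. `rad(abc) < c^{3/2}`:

* `squarefulSumCount_le_of_mazurKaneLaw` (registered sub-goal of stmt-ABC-2757):
  `MazurKaneLaw → ∀ ε > 0 ∃ C ∀ B ≥ 2, N₁(B) ≤ C · B^{1/2 + ε}`.

So promoting S5 ("MazurKaneLaw on (1, 5/3)") asks in particular for the upper-bound half of the BVV conjecture on
the Campana orbifold `(ℙ¹, ½[0]+½[1]+½[∞])` with exponent `1/2 + ε` (open; record `3/5`), just as the cdisprove gauge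
`abcHitCount_le_of_mazurKaneLaw` shows that `s → 1⁺` asks for abc hits `≪ N^δ` (record `0.6`). This is a PRICE OF THE
CRUX ITSELF (not of a lever), recorded so that planners rank the deep range accordingly.

References: T. D. Browning, K. Van Valckenborgh, *Sums of three squareful numbers*, Exp. Math. 21 (2012) 204–211,
Conj. 1 and Thm. 2 [BrowningValckenborgh2012]; D. Kane, arXiv:1104.2635, Conj. 1.
-/

noncomputable section

-- `Summit.<Summit>.<Problem>` is the mandated summit-side namespace; for the single-conjunct summit `ABC` the duplicate
-- `ABC.ABC` is deliberate (the lakefile sets the same option tree-wide).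
set_option linter.dupNamespace false

open Literature.NumberTheory.DiophantineGeometry UniqueFactorizationMonoid

namespace Summit.ABC.ABC.Theorems.MazurKaneLaw

/-- A squareful (`2`-powerful) number `n ≠ 0` satisfies `rad(n)² ≤ n`: writing `n = rad(n) · m`, every prime of `n`
divides `m` (else `p² ∣ rad(n)`, contradicting squarefreeness), so `rad(n) ∣ m`. -/
theorem radical_sq_le_of_isPowerful {n : ℕ} (hn : n ≠ 0) (h : IsPowerful 2 n) : radical n ^ 2 ≤ n := by
  obtain ⟨m, hm⟩ := (radical_dvd_self : radical n ∣ n)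
  have hm0 : m ≠ 0 := by rintro rfl; simp at hm; exact hn hm
  have hsub : n.primeFactors ⊆ m.primeFactors := by
    intro p hp
    have hpp : p.Prime := Nat.prime_of_mem_primeFactors hp
    have hp2 : p ^ 2 ∣ radical n * m := hm ▸ h p hp
    by_contra hpm
    have hndvd : ¬ p ∣ m := fun hd => hpm (Nat.mem_primeFactors.mpr ⟨hpp, hd, hm0⟩)
    have hcop : Nat.Coprime (p ^ 2) m := (Nat.Coprime.pow_left 2 ((Nat.Prime.coprime_iff_not_dvd hpp).mpr hndvd))
    have hp2r : p ^ 2 ∣ radical n := hcop.dvd_of_dvd_mul_right hp2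
    have hsq := (Nat.squarefree_iff_prime_squarefree.mp (squarefree_radical (a := n))) p hpp
    exact hsq (by simpa [pow_two] using hp2r)
  have hdvd : radical n ∣ m := (Nat.radical_dvd_iff hm0).mpr hsub
  calc radical n ^ 2 = radical n * radical n := pow_two _
    _ ≤ radical n * m := Nat.mul_le_mul_left _ (Nat.le_of_dvd (Nat.pos_of_ne_zero hm0) hdvd)
    _ = n := hm.symm

/-- For a squareful abc triple, `rad(abc) ≤ c^{3/2}` (indeed `rad(abc)² ≤ abc ≤ c³`). -/
theorem rad_le_rpow_three_halves_of_squareful {a b c : ℕ} (ht : IsABCTriple a b c) (ha : IsPowerful 2 a)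
    (hb : IsPowerful 2 b) (hc : IsPowerful 2 c) : ((rad a b c : ℕ) : ℝ) ≤ (c : ℝ) ^ (3 / 2 : ℝ) := by
  have hpow : IsPowerful 2 (a * b * c) := (ht.isPowerful_mul_iff 2).2 ⟨ha, hb, hc⟩
  obtain ⟨ha0, hb0, habc, -⟩ := ht
  have hc0 : 0 < c := by omega
  have hn : a * b * c ≠ 0 := by positivity
  have hle : rad a b c ^ 2 ≤ c ^ 3 := by
    rw [rad_def]
    calc radical (a * b * c) ^ 2 ≤ a * b * c := radical_sq_le_of_isPowerful hn hpow
      _ ≤ c * c * c := by gcongr <;> omega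
      _ = c ^ 3 := by ring
  have hreal : ((rad a b c : ℕ) : ℝ) ^ (2 : ℝ) ≤ (c : ℝ) ^ (3 : ℝ) := by
    have h2 : ((rad a b c : ℕ) : ℝ) ^ (2 : ℝ) = (((rad a b c ^ 2 : ℕ)) : ℝ) := by
      rw [show (2 : ℝ) = ((2 : ℕ) : ℝ) by norm_num, Real.rpow_natCast]; push_cast; ring
    have h3 : (c : ℝ) ^ (3 : ℝ) = (((c ^ 3 : ℕ)) : ℝ) := by
      rw [show (3 : ℝ) = ((3 : ℕ) : ℝ) by norm_num, Real.rpow_natCast]; push_cast; ring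
    rw [h2, h3]; exact_mod_cast hle
  have hr0 : (0 : ℝ) ≤ ((rad a b c : ℕ) : ℝ) := Nat.cast_nonneg _
  have hc0' : (0 : ℝ) ≤ (c : ℝ) := Nat.cast_nonneg _
  calc ((rad a b c : ℕ) : ℝ) = ((((rad a b c : ℕ) : ℝ)) ^ (2 : ℝ)) ^ (1 / 2 : ℝ) := by
        rw [← Real.rpow_mul hr0]; norm_num
    _ ≤ ((c : ℝ) ^ (3 : ℝ)) ^ (1 / 2 : ℝ) := Real.rpow_le_rpow (by positivity) hreal (by norm_num)
    _ = (c : ℝ) ^ (3 / 2 : ℝ) := by rw [← Real.rpow_mul hc0']; norm_num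

/-- **The crux at `s = 3/2` bounds three squareful numbers** (registered sub-goal `squarefulSumCount_le_of_mazurKaneLaw` of
stmt-ABC-2757): `MazurKaneLaw` implies `N₁(B) ≤ C_ε · B^{1/2+ε}` for all `B ≥ 2` — the conjectured exponent of
Browning–Van Valckenborgh (Conj. 1; record `3/5`, Thm. 2), since squareful abc triples have `rad(abc) ≤ c^{3/2}`. -/
theorem squarefulSumCount_le_of_mazurKaneLaw : Summit.ABC.ABC.Theses.TwistAmplification.MazurKaneLaw → ∀ ε : ℝ, 0 < ε → ∃ C : ℝ, ∀ B : ℕ, 2 ≤ B → (Literature.NumberTheory.DiophantineGeometry.squarefulSumCount B : ℝ) ≤ C * (B : ℝ) ^ (1 / 2 + ε) := by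
  intro hMK ε hε
  obtain ⟨C, hC⟩ := hMK (3 / 2) (by norm_num) (by norm_num) ε hε
  refine ⟨C, fun B hB => ?_⟩
  have hsub : {t : ℕ × ℕ × ℕ | IsABCTriple t.1 t.2.1 t.2.2 ∧ t.2.2 ≤ B ∧
      IsPowerful 2 t.1 ∧ IsPowerful 2 t.2.1 ∧ IsPowerful 2 t.2.2} ⊆
      {t : ℕ × ℕ × ℕ | IsABCTriple t.1 t.2.1 t.2.2 ∧ t.2.2 ≤ B ∧
        ((rad t.1 t.2.1 t.2.2 : ℕ) : ℝ) ≤ (t.2.2 : ℝ) ^ (3 / 2 : ℝ)} := by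
    rintro ⟨a, b, c⟩ ⟨ht, hcB, ha, hb, hc⟩
    exact ⟨ht, hcB, rad_le_rpow_three_halves_of_squareful ht ha hb hc⟩
  have hfin : {t : ℕ × ℕ × ℕ | IsABCTriple t.1 t.2.1 t.2.2 ∧ t.2.2 ≤ B ∧
      ((rad t.1 t.2.1 t.2.2 : ℕ) : ℝ) ≤ (t.2.2 : ℝ) ^ (3 / 2 : ℝ)}.Finite := by
    refine ((Set.finite_Iic B).prod ((Set.finite_Iic B).prod (Set.finite_Iic B))).subset ?_
    rintro ⟨a, b, c⟩ ⟨⟨ha, hb, habc, -⟩, hcB, -⟩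
    simp only [Set.mem_prod, Set.mem_Iic] at habc hcB ⊢
    omega
  have h1 := Set.ncard_le_ncard hsub hfin
  have h2 := hC B hB
  have hexp : (3 / 2 : ℝ) - 1 + ε = 1 / 2 + ε := by norm_num
  rw [hexp] at h2
  calc (squarefulSumCount B : ℝ)
      = ({t : ℕ × ℕ × ℕ | IsABCTriple t.1 t.2.1 t.2.2 ∧ t.2.2 ≤ B ∧
          IsPowerful 2 t.1 ∧ IsPowerful 2 t.2.1 ∧ IsPowerful 2 t.2.2}.ncard : ℝ) := by
        rw [squarefulSumCount_eq_ncard]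
    _ ≤ ({t : ℕ × ℕ × ℕ | IsABCTriple t.1 t.2.1 t.2.2 ∧ t.2.2 ≤ B ∧
          ((rad t.1 t.2.1 t.2.2 : ℕ) : ℝ) ≤ (t.2.2 : ℝ) ^ (3 / 2 : ℝ)}.ncard : ℝ) := by exact_mod_cast h1
    _ ≤ C * (B : ℝ) ^ (1 / 2 + ε) := h2

end Summit.ABC.ABC.Theorems.MazurKaneLaw

end
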